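import Summits.NavierStokesRegularity.NavierStokesRegularity.Theses.AxisymmetricExtremality
import HarnessLib

/-!
# Seregin 2020, Lemma 2.2 (after Nazarov–Uraltseva 2012): the slice gradient of a jointly
# measurable function with a.e.-differentiable slices is a.e.-strongly measurable

Helper toward the stub `stub_seregin2020TypeII` of the crux `AxisymmetricKatoGlobal` (= the named
fact `Literature.Analysis.FluidPDE.Seregin2020_axisymmetricSingularPoint_typeII`, G. Seregin,
Anal. Math. Phys. 10 (2020) Paper 46 = arXiv:2006.04140, Thm 2.1), reduced in the tree to the
written-out hypothesis `hWH′` (corrected Lemma 2.2 = Nazarov–Uraltseva 2012 Lemma 4.2 for the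
class 𝒱). The De Giorgi chain of N–U §3 (pieces L22-C of the cell pub/ns-inputs) is typed
against standing hypotheses in which the function `Φ` is only jointly Borel measurable with `C¹`
slices `Φ(t, ·)` for a.e. time `t` (the time projection of the `𝒫¹`-null singular set is null),
while every energy argument integrates the slice gradient `(t, x) ↦ ∇Φ(t,·)(x)` in space–time
(Tonelli, Cauchy–Schwarz). This file supplies the measurability that makes those integrals
honest:

* `ContinuousLinearMap.eq_sum_apply_single_smul_proj` — a functional on `ℝ³` is the sum of its
  values on the standard basis times the coordinate projections;
* `aestronglyMeasurable_fderiv_slice_of_ae_differentiable` — if `uncurry Φ` is measurable and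
  for `μ`-a.e. `t` the slice `Φ t` is differentiable (everywhere), then
  `z ↦ fderiv ℝ (Φ z.1) z.2` is a.e.-strongly measurable for `(μ.prod ν)` (`ν` any σ-finite
  measure on `ℝ³` absolutely continuous along translations is NOT needed: the difference
  quotients `n (Φ(t, x + e/n) - Φ(t, x))` are jointly measurable for every `n`, and converge to
  `∂ₑΦ(t,·)(x)` wherever the slice is differentiable — Mathlib's `HasFDerivAt.lim` — so
  `aemeasurable_of_tendsto_metrizable_ae` applies coordinatewise);
* `aestronglyMeasurable_fderiv_slice_restrict_prod` — the form used by the atoms: on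
  `volume.restrict (I ×ˢ B)` from `∀ᵐ t ∂(volume.restrict I), Differentiable ℝ (Φ t)`.

## References

* A. I. Nazarov, N. N. Uraltseva, St. Petersburg Math. J. 23 (2012) 93–115 = arXiv:1011.1888,
  §3 (the energy class `𝒱`, Lemmata 3.1–3.3). [NazarovUraltseva2012]
* G. Seregin, Anal. Math. Phys. 10 (2020), Paper 46 = arXiv:2006.04140, Lemma 2.2, class 𝒱.
  [Seregin2020]
-/

-- the problem directory repeats the summit name (D-0017); core's `dupNamespace` linter fires
set_option linter.dupNamespace false

noncomputable section

open MeasureTheory Set Function Filter Topology Metric Module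
open scoped NNReal ENNReal

namespace Summit.NavierStokesRegularity.NavierStokesRegularity.Theorems.AxisymmetricKatoGlobal.EulerScaling

/-- A continuous linear functional on `ℝ³` is the sum over the standard basis of its values
times the coordinate projections: `L = Σᵢ L(eᵢ) • projᵢ`. [folklore] -/
theorem ContinuousLinearMap.eq_sum_apply_single_smul_proj
    (L : EuclideanSpace ℝ (Fin 3) →L[ℝ] ℝ) :
    L = ∑ i : Fin 3, L (EuclideanSpace.single i (1 : ℝ)) • (EuclideanSpace.proj i) := by
  ext x
  have hx : x = ∑ i : Fin 3, x i • EuclideanSpace.single i (1 : ℝ) := by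
    simpa using ((EuclideanSpace.basisFun (Fin 3) ℝ).sum_repr x).symm
  conv_lhs => rw [hx]
  simp only [map_sum, map_smul, smul_eq_mul, sum_apply, smul_apply]
  refine Finset.sum_congr rfl fun i _ => ?_
  rw [mul_comm]
  rfl

/-- **Joint a.e.-measurability of the slice gradient.** Let `Φ : ℝ → ℝ³ → ℝ` have measurable
`uncurry Φ`, and let `μ`, `ν` be σ-finite measures on `ℝ` and `ℝ³` with `ν ≪ volume`-free
hypotheses: if for `μ`-a.e. `t` the slice `Φ t` is differentiable at every point, then
`z ↦ fderiv ℝ (Φ z.1) z.2` is a.e.-strongly measurable for `μ.prod ν`. (Difference quotients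
along `eᵢ/n` are measurable and converge a.e. to `∂ᵢΦ`; `L = Σᵢ L(eᵢ) projᵢ`.) [folklore] -/
theorem aestronglyMeasurable_fderiv_slice_of_ae_differentiable
    {Φ : ℝ → EuclideanSpace ℝ (Fin 3) → ℝ} (hΦ : Measurable (uncurry Φ))
    (μ : Measure ℝ) (ν : Measure (EuclideanSpace ℝ (Fin 3))) [SFinite μ] [SFinite ν]
    (hdiff : ∀ᵐ t ∂μ, Differentiable ℝ (Φ t)) :
    AEStronglyMeasurable (fun z : ℝ × EuclideanSpace ℝ (Fin 3) => fderiv ℝ (Φ z.1) z.2)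
      (μ.prod ν) := by
  -- a.e. `z`, the slice through `z` is differentiable at `z.2`
  have hae : ∀ᵐ z ∂(μ.prod ν), DifferentiableAt ℝ (Φ z.1) z.2 := by
    have h := (Measure.quasiMeasurePreserving_fst (μ := μ) (ν := ν)).ae hdiff
    filter_upwards [h] with z hz
    exact hz z.2
  -- the coordinate derivatives are a.e.-measurable (limits of difference quotients)
  have hcoord : ∀ i : Fin 3, AEMeasurable (fun z : ℝ × EuclideanSpace ℝ (Fin 3) =>
      fderiv ℝ (Φ z.1) z.2 (EuclideanSpace.single i (1 : ℝ))) (μ.prod ν) := by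
    intro i
    set e : EuclideanSpace ℝ (Fin 3) := EuclideanSpace.single i (1 : ℝ) with he
    set q : ℕ → ℝ × EuclideanSpace ℝ (Fin 3) → ℝ := fun n z =>
      ((n : ℝ) + 1) * (Φ z.1 (z.2 + ((n : ℝ) + 1)⁻¹ • e) - Φ z.1 z.2) with hq
    have hqm : ∀ n, AEMeasurable (q n) (μ.prod ν) := by
      intro n
      have h1 : Measurable fun z : ℝ × EuclideanSpace ℝ (Fin 3) =>
          Φ z.1 (z.2 + ((n : ℝ) + 1)⁻¹ • e) := by
        have hs : Measurable fun z : ℝ × EuclideanSpace ℝ (Fin 3) =>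
            ((z.1, z.2 + ((n : ℝ) + 1)⁻¹ • e) : ℝ × EuclideanSpace ℝ (Fin 3)) :=
          measurable_fst.prodMk (measurable_snd.add_const _)
        exact hΦ.comp hs
      have h2 : Measurable fun z : ℝ × EuclideanSpace ℝ (Fin 3) => Φ z.1 z.2 := hΦ
      exact ((h1.sub h2).const_mul _).aemeasurable
    refine aemeasurable_of_tendsto_metrizable_ae (u := atTop) hqm ?_
    filter_upwards [hae] with z hz
    have hc : Tendsto (fun n : ℕ => ‖((n : ℝ) + 1)‖) atTop atTop := by
      have h : Tendsto (fun n : ℕ => (n : ℝ) + 1) atTop atTop :=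
        tendsto_atTop_add_const_right _ 1 tendsto_natCast_atTop_atTop
      refine (tendsto_atTop_mono (fun n => ?_) h)
      exact Real.le_norm_self _
    have hlim := hz.hasFDerivAt.lim e hc
    simpa only [hq, smul_eq_mul] using hlim
  -- assemble the functional from its coordinates
  have hsum : (fun z : ℝ × EuclideanSpace ℝ (Fin 3) => fderiv ℝ (Φ z.1) z.2) =
      ∑ i : Fin 3, fun z : ℝ × EuclideanSpace ℝ (Fin 3) =>
        fderiv ℝ (Φ z.1) z.2 (EuclideanSpace.single i (1 : ℝ)) •
          (EuclideanSpace.proj i : EuclideanSpace ℝ (Fin 3) →L[ℝ] ℝ) := by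
    funext z
    rw [Finset.sum_apply]
    exact ContinuousLinearMap.eq_sum_apply_single_smul_proj _
  rw [hsum]
  refine Finset.aestronglyMeasurable_sum _ fun i _ => ?_
  exact (hcoord i).aestronglyMeasurable.smul_const _

/-- **The form used by the N–U atoms**: on the cylinder `I × B`, if `uncurry Φ` is measurable
and for a.e. `t ∈ I` the slice `Φ t` is differentiable, then the slice gradient is
a.e.-strongly measurable for `volume.restrict (I ×ˢ B)`. [folklore] -/
theorem aestronglyMeasurable_fderiv_slice_restrict_prod
    {Φ : ℝ → EuclideanSpace ℝ (Fin 3) → ℝ} (hΦ : Measurable (uncurry Φ))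
    {I : Set ℝ} {B : Set (EuclideanSpace ℝ (Fin 3))}
    (hdiff : ∀ᵐ t ∂(volume.restrict I), Differentiable ℝ (Φ t)) :
    AEStronglyMeasurable (fun z : ℝ × EuclideanSpace ℝ (Fin 3) => fderiv ℝ (Φ z.1) z.2)
      (volume.restrict (I ×ˢ B)) := by
  have h := aestronglyMeasurable_fderiv_slice_of_ae_differentiable hΦ
    (volume.restrict I) (volume.restrict B) hdiff
  rwa [Measure.prod_restrict, ← Measure.volume_eq_prod] at h

end Summit.NavierStokesRegularity.NavierStokesRegularity.Theorems.AxisymmetricKatoGlobal.EulerScaling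

end
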